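import Mathlib
import HarnessLib
import Literature.Computability.AlgebraicComplexity.DawarWilsenach2025
import Summits.ValiantsHypothesis.ValiantsHypothesis.Theorems.MonotoneRestorationMonotoneRestorationQPZetaPatterns
import Summits.ValiantsHypothesis.ValiantsHypothesis.Theorems.MonotoneRestorationOrbitRestorationQPEquivariantTermsTools
import Summits.ValiantsHypothesis.ValiantsHypothesis.Theorems.MonotoneRestorationOrbitRestorationQPDepthThreeRungDefs

/-!
# Route MonotoneRestoration — crux `OrbitRestorationQP` (stmt-ValiantsHypothesis-18293), line
# `depth-three-rung`: stub B `stub_circuitOfEquivariantTerms` LANDED — the square-symmetric circuit of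
# an equivariant multiset of products of affine forms has quasi-polynomial orbit size

Registered stub B of `Cruxes/OrbitRestorationQP/Lines/depth_three_rung.lean` (fwd-ladder G4), BY NAME
AND SIGNATURE, over the line's vocabulary `IsEquivariantTerms` / `QPOrbitRestorable`
(`…OrbitRestorationQPDepthThreeRungDefs.lean`, verbatim the skeleton's): for every family `T n` of
multisets of multisets of affine forms (`totalDegree ≤ 1`) on the `n × n` variable matrix with
`|T n| ≤ 2^((log₂ n + c)^c)`, every member of cardinality `≤ 2^((log₂ n + c)^c)`, and `T n` STABLE
under the diagonal action of `Sym(Fin n)`, the polynomial `Σ_{m ∈ T n} Π m` has square-symmetric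
labelled arithmetic circuits over `ℂ` whose ORBIT size (Dawar–Wilsenach `orbitSize`, §3.3) is
`≤ 2^((log₂ n + c')^c')`.  The skeleton's `sorry` is replaced by
`exact Summit.ValiantsHypothesis.ValiantsHypothesis.Theorems.OrbitRestorationQPDepthThreeRung.stub_circuitOfEquivariantTerms`
(its local abbreviations unfold to the same bodies).

Proof: the route-independent construction `eqvTerms_symmetric_size`
(`…OrbitRestorationQPEquivariantTermsTools.lean`: a square-symmetric circuit of SIZE
`≤ 2n² + 4s²n² + 6s² + s⁴ + 6s + 6`, `s = 2^((log₂ n + c)^c)`, from the tree's equivariant multi-output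
circuit calculus), then `orbitSize ≤ size` (`orbitSize_le_size`) and
`25 (n+2)² s⁴ ≤ 2^((log₂ n + c')^c')` (`zeta_poly_mul_qp_le`, THEOREM ζ bookkeeping); the levels `n = 0`
(no variables) and `T n = 0` are one-gate constant circuits (`zeta_symmetric_constant`).

With stub A (`stub_equivariantTerms`, conjecture-grade: an equivariant depth-3 normal form of
quasi-polynomial size) this gives the line's rung `SigmaPiSigmaRestorationQP`
(`SigmaPiSigmaRestorationQP_of` in the skeleton).  VP ≠ VNP is not moved by this file: the crux
`OrbitRestorationQP` itself is a declared strict strengthening of VH and stays open.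

## References
* A. Dawar, G. Wilsenach, *Symmetric arithmetic circuits*, ToC 21 (2025), Defs. 2.2, 3.6, 3.7, §3.3
  (`ORB ≤ size`). [DawarWilsenach2025]
* A. Dawar, B. Pago, T. Seppelt, *Symmetric algebraic circuits and homomorphism polynomials*,
  arXiv:2502.06740 (2025), §5. [DawarPagoSeppelt2025]
-/

noncomputable section

set_option linter.dupNamespace false

namespace Summit.ValiantsHypothesis.ValiantsHypothesis.Theorems.OrbitRestorationQPDepthThreeRung

open Literature.Computability.AlgebraicComplexity
open Summit.ValiantsHypothesis.ValiantsHypothesis.Theorems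

/-- **Stub B of line `depth-three-rung` (`stub_circuitOfEquivariantTerms`), by name and signature:**
an `Sym_n`-STABLE multiset of quasi-polynomially many products of quasi-polynomially many affine forms
on the `n × n` matrix (`IsEquivariantTerms`) is computed, at every level `n`, by a square-symmetric
labelled arithmetic circuit over `ℂ` of quasi-polynomial ORBIT size (`QPOrbitRestorable`) — indeed of
quasi-polynomial SIZE (`eqvTerms_symmetric_size`) and `orbitSize ≤ size`.  Degenerate levels `n = 0`
and `T n = 0` are one-gate constants. [cite: DawarWilsenach2025, §3.3 (ORB ≤ size); DawarPagoSeppelt2025, §5] -/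
theorem stub_circuitOfEquivariantTerms :
    ∀ (T : (n : ℕ) → Multiset (Multiset (MvPolynomial (Fin n × Fin n) ℂ))) (c : ℕ),
      (∀ n : ℕ, IsEquivariantTerms n c (T n)) →
      ∃ c' : ℕ, ∀ n : ℕ, QPOrbitRestorable c' n (((T n).map Multiset.prod).sum) := by
  intro T c hT
  obtain ⟨c₃, hc₃⟩ := zeta_poly_mul_qp_le 25 2 c 4
  refine ⟨c₃, fun n => ?_⟩
  have hone : ∀ m : ℕ, 1 ≤ 2 ^ ((Nat.log 2 m + c₃) ^ c₃) := fun _ => Nat.one_le_two_pow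
  unfold QPOrbitRestorable
  rcases Nat.eq_zero_or_pos n with rfl | hn
  · -- `n = 0`: no variables, the polynomial is a constant
    obtain ⟨G, inst, C, hC, hev, hcard⟩ := zeta_symmetric_constant (X := Fin 0 × Fin 0)
      (Γ := Equiv.Perm (Fin 0)) (MvPolynomial.coeff 0 (((T 0).map Multiset.prod).sum))
    refine ⟨G, inst, C, hC, ?_, ((C.orbitSize_le_size _).trans hcard).trans (hone 0)⟩
    rw [hev]
    exact (MvPolynomial.eq_C_of_isEmpty _).symm
  · haveI : NeZero n := ⟨by omega⟩
    by_cases hT0 : T n = 0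
    · -- `T n = 0`: the polynomial `0`
      obtain ⟨G, inst, C, hC, hev, hcard⟩ := zeta_symmetric_constant (X := Fin n × Fin n)
        (Γ := Equiv.Perm (Fin n)) (0 : ℂ)
      refine ⟨G, inst, C, hC, ?_, ((C.orbitSize_le_size _).trans hcard).trans (hone n)⟩
      rw [hev, hT0, Multiset.map_zero, Multiset.sum_zero, map_zero]
    · obtain ⟨h1, h2, h3, h4⟩ := hT n
      obtain ⟨G, inst, C, hC, hev, hcard⟩ :=
        eqvTerms_symmetric_size (2 ^ ((Nat.log 2 n + c) ^ c)) (T n) hT0 h1 h2 h3 h4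
      refine ⟨G, inst, C, hC, hev, (C.orbitSize_le_size _).trans (hcard.trans ?_)⟩
      refine (eqvTerms_size_arith n _ Nat.one_le_two_pow).trans ?_
      rw [← pow_mul, mul_comm ((Nat.log 2 n + c) ^ c) 4]
      exact hc₃ n

end Summit.ValiantsHypothesis.ValiantsHypothesis.Theorems.OrbitRestorationQPDepthThreeRung

end
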